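import Mathlib
import Summits.NavierStokesRegularity.NavierStokesRegularity.Theorems.ThreadingFluxAzimuthalCartanConicalWitnessNoAxis
import HarnessLib

/-!
# Crux `PoloidalLiouville` (stmt-NavierStokesRegularity-1222, wall W1), crux idea «azimuthal-cartan-test» (ns-idea-15 g10):
# THE RATIONAL CONICAL FLOW ON ITS WHOLE CONE — steady NS on `ℝ³` minus the vertex and four rays, with no symmetry axis

Support file (`--supports stmt-NavierStokesRegularity-1222`, helper; cell `ns-wall-extremal`, width hand ns-wall-eng-6 g5, 0 kit).
Sequel of `…ConicalWitness` / `…ConicalWitnessNoAxis` (K♯ `poloidalConicalFlows` on the ball `B((1,1,1), ½)`).  The same explicit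
flow `u = conicalField Φ`, `e^{Φ} = N/D²`, lives on the whole open cone `coneSet = {x | 0 < N x}`, and this file records the sharp
placement against ŠVERÁK'S THEOREM (tree: `Sverak2011_landauClassification` — a `(−1)`-homogeneous steady NS flow smooth on ALL of
`ℝ³ ∖ {0}` is a Landau flow, hence axisymmetric):

* `quartN_eq_sq_add` / `quartN_pos_iff` — `N = (3x₀² − 5x₁²)² + 16x₂²(3x₀² + 5x₁² + 4x₂²)`, so `coneSet = {x₂ ≠ 0 ∨ 3x₀² ≠ 5x₁²}`:
  the complement of `coneSet` is EXACTLY the vertex together with the four rays `ℝ·(±√5, ±√3, 0)` (two lines through the vertex);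
* the Liouville data on the whole cone: `liouvilleCone_coneSet : LiouvilleCone coneSet potential grad hess` (the identities of
  `…ConicalWitness` only use `N ≠ 0`, `D ≠ 0`);
* ★ `steadyNS_on_coneSet` — `u` is a real-analytic classical steady Navier–Stokes flow on `coneSet`, unthreaded and `(−1)`-homogeneous
  about the vertex, with `curl u = (2N/(D²|x|²)) (∇Φ × x)`;
* ★ `noAxis_coneSet` — it has NO symmetry axis through the vertex on `coneSet` (restriction to the ball of `…NoAxis`).

So removing two lines through the origin from Šverák's hypothesis `smooth on ℝ³ ∖ {0}` already admits NON-axisymmetric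
`(−1)`-homogeneous steady flows (here an explicit rational one); information for the W1 Cartan line (surviving rigid shapes: full
shells about the centre, eng-6 g4 `Homogeneous.steadyShellRigidity_of_homogeneous`).  HONEST FRAME: one explicit flow; closes no crux;
`PoloidalLiouville` (1222) and NS regularity OPEN / NOT proved.  [Šverák arXiv:math/0604550 Thm 1; Li–Li–Yan arXiv:1609.08197 for
homogeneous solutions with isolated singular rays.]
-/

-- the summit and its single sub-problem share the name (CONVENTIONS §1)
set_option linter.dupNamespace false

noncomputable section

namespace Summit.NavierStokesRegularity.NavierStokesRegularity.Theorems.PoloidalLiouville.AzimuthalCartan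

open Set Function Filter Topology Metric
open scoped ContDiff RealInnerProductSpace
open Literature.Analysis.FluidPDE
open Summit.NavierStokesRegularity.NavierStokesRegularity.Theorems.PoloidalLiouville.CentreJet (E3 IsSteadyNSOn)

namespace ConicalWitness

/-! ### The cone of smoothness and its complement -/

/-- The open cone `{N > 0}` on which `e^{Φ} = N/D²` is positive (the cone of smoothness of the flow). -/
abbrev coneSet : Set E3 := {x | 0 < quartN x}

/-- `N` as a sum of squares: `N = (3x₀² − 5x₁²)² + 16x₂²(3x₀² + 5x₁² + 4x₂²)`. -/
theorem quartN_eq_sq_add (x : E3) :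
    quartN x = (3 * x 0 ^ 2 - 5 * x 1 ^ 2) ^ 2 + 16 * x 2 ^ 2 * (3 * x 0 ^ 2 + 5 * x 1 ^ 2 + 4 * x 2 ^ 2) := by
  rw [quartN]; ring

/-- `N ≥ 0` everywhere. -/
theorem quartN_nonneg (x : E3) : 0 ≤ quartN x := by
  rw [quartN_eq_sq_add]; positivity

/-- **The singular set is the vertex and four rays**: `N > 0 ↔ (x₂ ≠ 0 ∨ 3x₀² ≠ 5x₁²)`; i.e. `N = 0` exactly on the two lines
`{x₂ = 0, √3 x₀ = ±√5 x₁}` through the vertex. -/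
theorem quartN_pos_iff (x : E3) : 0 < quartN x ↔ x 2 ≠ 0 ∨ 3 * x 0 ^ 2 ≠ 5 * x 1 ^ 2 := by
  rw [quartN_eq_sq_add]
  constructor
  · intro h
    by_contra hc
    simp only [not_or, ne_eq, not_not] at hc
    rw [hc.1, hc.2] at h
    simp at h
  · rintro (h2 | h01)
    · have : 0 < 16 * x 2 ^ 2 * (3 * x 0 ^ 2 + 5 * x 1 ^ 2 + 4 * x 2 ^ 2) := by positivity
      nlinarith [sq_nonneg (3 * x 0 ^ 2 - 5 * x 1 ^ 2)]
    · have : 0 < (3 * x 0 ^ 2 - 5 * x 1 ^ 2) ^ 2 := by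
        have h' : 3 * x 0 ^ 2 - 5 * x 1 ^ 2 ≠ 0 := sub_ne_zero.2 h01
        positivity
      nlinarith [sq_nonneg (x 2), mul_nonneg (mul_nonneg (by norm_num : (0:ℝ) ≤ 16) (sq_nonneg (x 2)))
        (by positivity : (0:ℝ) ≤ 3 * x 0 ^ 2 + 5 * x 1 ^ 2 + 4 * x 2 ^ 2)]

/-- `coneSet` is open. -/
theorem isOpen_coneSet : IsOpen coneSet := isOpen_lt continuous_const contDiff_quartN.continuous

/-- The cone misses the vertex (`N(0) = 0`). -/
theorem ne_zero_of_mem_coneSet {x : E3} (hx : x ∈ coneSet) : x ≠ 0 := by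
  rintro rfl
  simp [coneSet, quartN] at hx

/-- `D > 0` on the cone (`D > 0` off the vertex). -/
theorem quadD_pos_of_mem_coneSet {x : E3} (hx : x ∈ coneSet) : 0 < quadD x := by
  have hx0 := ne_zero_of_mem_coneSet hx
  rw [quadD]
  by_contra h
  replace h := not_lt.1 h
  have h0 : x 0 = 0 := by nlinarith [sq_nonneg (x 0), sq_nonneg (x 1), sq_nonneg (x 2)]
  have h1 : x 1 = 0 := by nlinarith [sq_nonneg (x 0), sq_nonneg (x 1), sq_nonneg (x 2)]
  have h2 : x 2 = 0 := by nlinarith [sq_nonneg (x 0), sq_nonneg (x 1), sq_nonneg (x 2)]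
  apply hx0
  ext i
  fin_cases i <;> simp [h0, h1, h2]

/-- The witness ball lies in the cone. -/
theorem coneBall_subset_coneSet : coneBall ⊆ coneSet := fun y hy => by
  show 0 < quartN y
  linarith [four_lt_quartN hy]

/-! ### The identities of `…ConicalWitness` on the whole cone -/

variable {x : E3}

/-- EULER on the cone. -/
theorem inner_grad_of_mem_coneSet (hx : x ∈ coneSet) : ⟪x, grad x⟫ = 0 := by
  have hN : quartN x ≠ 0 := (show 0 < quartN x from hx).ne'
  have hD : quadD x ≠ 0 := (quadD_pos_of_mem_coneSet hx).ne'
  rw [grad, inner_sub_right, inner_smul_right, inner_smul_right, inner_gradN, inner_gradD]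
  field_simp
  ring

/-- LIOUVILLE on the cone. -/
theorem liouville_identity_of_mem_coneSet (hx : x ∈ coneSet) :
    ‖x‖ ^ 2 * (∑ i, hess x (EuclideanSpace.single i 1) i) + 2 * (quartN x / quadD x ^ 2) - 2 = 0 := by
  have hN : quartN x ≠ 0 := (show 0 < quartN x from hx).ne'
  have hD : quadD x ≠ 0 := (quadD_pos_of_mem_coneSet hx).ne'
  rw [trace_hess, EuclideanSpace.real_norm_sq_eq, Fin.sum_univ_three]
  field_simp
  simp only [quartN, quadD]
  ring

/-- `e^{Φ} = N/D²` on the cone. -/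
theorem exp_potential_of_mem_coneSet (hx : x ∈ coneSet) : Real.exp (potential x) = quartN x / quadD x ^ 2 := by
  have hN : 0 < quartN x := hx
  have hD := quadD_pos_of_mem_coneSet hx
  rw [potential, Real.exp_sub, Real.exp_log hN, show 2 * Real.log (quadD x) = Real.log (quadD x ^ 2) by
    rw [Real.log_pow]; norm_num, Real.exp_log (by positivity)]

/-- `DΦ = ⟪g, ·⟫` on the cone. -/
theorem hasFDerivAt_potential_of_mem_coneSet (hx : x ∈ coneSet) : HasFDerivAt potential (innerSL ℝ (grad x)) x := by
  have hN : quartN x ≠ 0 := (show 0 < quartN x from hx).ne'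
  have hD : quadD x ≠ 0 := (quadD_pos_of_mem_coneSet hx).ne'
  have h := ((hasFDerivAt_quartN x).log hN).sub (((hasFDerivAt_quadD x).log hD).const_mul 2)
  refine h.congr_fderiv ?_
  ext v
  simp only [grad, sub_apply, smul_apply, innerSL_apply_apply, smul_eq_mul, inner_sub_left, inner_smul_left, conj_trivial]
  ring

/-- `Dg = H` on the cone. -/
theorem hasFDerivAt_grad_of_mem_coneSet (hx : x ∈ coneSet) : HasFDerivAt grad (hess x) x := by
  have hN : quartN x ≠ 0 := (show 0 < quartN x from hx).ne'
  have hD : quadD x ≠ 0 := (quadD_pos_of_mem_coneSet hx).ne'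
  have hinvN : HasFDerivAt (fun y => (quartN y)⁻¹) ((-(quartN x ^ 2)⁻¹) • innerSL ℝ (gradN x)) x :=
    (hasDerivAt_inv hN).comp_hasFDerivAt x (hasFDerivAt_quartN x)
  have hinvD : HasFDerivAt (fun y => 2 / quadD y) ((quadD x)⁻¹ • (0 : E3 →L[ℝ] ℝ) - (2 / quadD x ^ 2) • innerSL ℝ (gradD x)) x :=
    HalfSpace.hasFDerivAt_div (hasFDerivAt_const (2 : ℝ) x) (hasFDerivAt_quadD x) hD
  have h := (hinvN.smul (hasFDerivAt_gradN x)).sub (hinvD.smul (hasFDerivAt_gradD x))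
  refine h.congr_fderiv ?_
  ext v i
  simp only [hess, add_apply, sub_apply, smul_apply, neg_apply, ContinuousLinearMap.smulRight_apply, innerSL_apply_apply,
    PiLp.add_apply, PiLp.sub_apply, PiLp.smul_apply, smul_eq_mul, smul_zero, zero_sub]
  ring

/-- `Φ` is real-analytic on the cone. -/
theorem analyticAt_potential_of_mem_coneSet (hx : x ∈ coneSet) : AnalyticAt ℝ potential x := by
  have hN : 0 < quartN x := hx
  have hD := quadD_pos_of_mem_coneSet hx
  exact ((analyticAt_log hN).comp contDiff_quartN.contDiffAt.analyticAt).sub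
    (analyticAt_const.mul ((analyticAt_log hD).comp contDiff_quadD.contDiffAt.analyticAt))

/-- **The rational witness is Liouville data on its whole cone of smoothness.** -/
theorem liouvilleCone_coneSet : LiouvilleCone coneSet potential grad hess where
  isOpen := isOpen_coneSet
  ne_zero := fun _ hy => ne_zero_of_mem_coneSet hy
  analyticOnNhd := fun _ hy => analyticAt_potential_of_mem_coneSet hy
  hasFDerivAt_potential := fun _ hy => hasFDerivAt_potential_of_mem_coneSet hy
  hasFDerivAt_gradient := fun _ hy => hasFDerivAt_grad_of_mem_coneSet hy
  euler := fun _ hy => inner_grad_of_mem_coneSet hy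
  liouville := fun y hy => by rw [exp_potential_of_mem_coneSet hy]; exact liouville_identity_of_mem_coneSet hy

/-! ### The flow on the whole cone -/

/-- ★ **Steady Navier–Stokes on the whole cone.**  The rational conical flow `u = conicalField Φ` (`e^{Φ} = N/D²`) with pressure
`conicalPressure Φ` is a real-analytic classical steady NS flow on `coneSet = ℝ³ ∖ ({0} ∪ four rays)`, unthreaded and
`(−1)`-homogeneous about the vertex, with `curl u = (2e^{Φ}/|x|²)(∇Φ × x)` (non-zero at `(1,1,1)`). -/
theorem steadyNS_on_coneSet :
    AnalyticOnNhd ℝ (conicalField potential) coneSet ∧ AnalyticOnNhd ℝ (conicalPressure potential) coneSet ∧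
      IsSteadyNSOn coneSet (conicalField potential) (conicalPressure potential) ∧
      IsUnthreadedOn coneSet 0 (conicalField potential) ∧ IsMinusOneHomogeneousOn coneSet 0 (conicalField potential) ∧
      ∀ y ∈ coneSet, curl (conicalField potential) y = (2 * Real.exp (potential y) / ‖y‖ ^ 2) • cross (grad y) y :=
  liouvilleCone_coneSet.correspondence

/-- ★ **No symmetry axis on the cone**: no non-zero skew `A` makes `u` infinitesimally `A`-equivariant about the vertex on `coneSet`
(it already fails on the ball `B((1,1,1), ½) ⊆ coneSet`).  Contrast: Šverák — smooth on all of `ℝ³ ∖ {0}` ⇒ Landau ⇒ axisymmetric. -/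
theorem noAxis_coneSet :
    ¬ ∃ A : E3 →L[ℝ] E3, IsSkewAxis A ∧ IsEquivariantOn coneSet 0 A (conicalField potential) ∧
      HasConstantSwirlOn coneSet 0 A (conicalField potential) := by
  rintro ⟨A, hA, hE, ⟨κ, hκ⟩⟩
  exact noAxis ⟨A, hA, fun y hy => hE y (coneBall_subset_coneSet hy), ⟨κ, fun y hy => hκ y (coneBall_subset_coneSet hy)⟩⟩

/-- The flow is not potential on the cone: `curl u ≠ 0` at `(1,1,1) ∈ coneSet`. -/
theorem exists_curl_ne_zero_coneSet : ∃ y ∈ coneSet, curl (conicalField potential) y ≠ 0 :=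
  ⟨xOne, coneBall_subset_coneSet xOne_mem, curl_conicalField_xOne_ne_zero⟩

end ConicalWitness

end Summit.NavierStokesRegularity.NavierStokesRegularity.Theorems.PoloidalLiouville.AzimuthalCartan

end
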